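import Mathlib
import HarnessLib

/-!
HONEST FRAMING: exact (Metropolis-corrected) sampling algorithms for lattice gauge theory; figures
of merit are autocorrelation/cost numbers at stated couplings and volumes; no continuum-physics
claim.

# LadderRobinMode — THE SLOWEST ONE-LEVEL MODE OF THE HOMOGENEOUS LADDER: `c_n = cos(θ(K+½−n))` SOLVES THE INTERIOR AND THE NEUMANN-END
# EQUATIONS OF `(t/K)Δ − h·e_0e_0ᵀ` FOR EVERY `θ` WITH RATE `ρ = (2t/K)(1 − cos θ)`, THE ROBIN-END EQUATION HAS A ROOT `θ ∈ (0, π/(2K+1))`, AND THEN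
# `K(2K+1)²/(π²t) ≤ 1/ρ`, `4tθ² ≤ π²Kρ`, `4h·c_0² ≤ π²(K+1)ρ`, `(tθ² + h·c_0²)/ρ ≤ 5(K+1)`, `Σ_{k ≤ K} c_k ≥ (K+1)/3` (lean-2 GEN-47, ours)

Venture-side (OURS).  Cell `lqcd-flow` (pub-lqcd), unit `pub-lqcd-lean-2-g47`, 2026-08-31.  Chapter AG (the homogeneous ladder's law-free `K³·log K` floor),
file 1 — Mathlib only.  The homogeneous replica-exchange LADDER (one law `ν` at each of `K+1` levels, a uniformly proposed adjacent swap with probability `t`, always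
accepted, an exact hot redraw at level `0` with probability `h`) moves the one-level statistics `a(x_k)` (`a` centred for `ν`) IN EXPECTATION by the symmetric matrix
`Q = I + (t/K)·Δ_Neumann − h·e_0e_0ᵀ` on `ℝ^{K+1}` (file 2).  This file is the spectral input: the vector `c_n = cos(θ(K+½−n))` (`n = 0` the hot level, `n = K` the far
end) satisfies the interior equations `(t/K)(c_{n−1} − 2c_n + c_{n+1}) = −ρc_n` and the Neumann-end equation `(t/K)(c_{K−1} − c_K) = −ρc_K` for EVERY `θ`, with
`ρ = (2t/K)(1 − cos θ)` (two cosine identities), and the hot-end (Robin) equation `(t/K)(c_1 − c_0) − h·c_0 = −ρc_0` exactly when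
`h·cos(θ(K+½)) = (t/K)(cos(θ(K+½)) − cos(θ(K+3/2)))`, which has a root `θ ∈ (0, π/(2K+1))` by the intermediate value theorem (`K ≥ 1`, `t, h > 0`: the left side
falls from `h` to `0`, the right side rises from `0` to `(t/K)·sin(π/(2K+1))`).  At such a root: `0 < ρ < t/K`, `ρ·K(2K+1)² ≤ tπ²` (so `1/ρ ≥ K(2K+1)²/(π²t)` — order
`K³/t`), `4tθ² ≤ π²Kρ`, and the one estimate that needs care, **`4h·c_0² ≤ π²(K+1)ρ` UNIFORMLY IN `θ`** (`h·c_0 = (2t/K)·sin(θ(K+1))·sin(θ/2) ≤ tθ²(K+1)/K` by the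
Robin equation and `sin y ≤ y` twice, against `1 − cos θ ≥ 2θ²/π²`), whence `(tθ² + h·c_0²)/ρ ≤ 5(K+1)`; `(c_n − c_{n+1})² ≤ θ²`, `|c_n| ≤ 1`; and
`Σ_{k=0}^{K} c_k ≥ (K+1)/3` (`cos y ≥ 1 − 2y/π` on `[0, π/2]`).  Hypothesis-equations only (`hc`, `hρ`, `hrobin`), no definitions.

* §1 `robin_cos_shift`; **`robinMode_interior`**, **`robinMode_neumann`**, **`robinMode_robin`** (the three equations); §2 **`robinMode_exists`** (IVT);
  §3 `robinMode_theta_le`, **`robinMode_rho_pos`**, **`robinMode_rho_lt`**, **`robinMode_rho_mul_le`** (`ρK(2K+1)² ≤ tπ²`), **`robinMode_theta_sq_le`** (`4tθ² ≤ π²Kρ`),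
  `robinMode_c_abs_le`, `robinMode_c_diff_sq_le`, `robinMode_c0_nonneg`, **`robinMode_hot_sq_le`** (`4hc_0² ≤ π²(K+1)ρ`), **`robinMode_increment_le`**
  (`(tθ² + hc_0²) ≤ 5(K+1)ρ`); §4 `sum_fin_cast_eq`, **`robinMode_sum_ge`** (`Σ_k c_k ≥ (K+1)/3`).

Reading (no numerics implied): the slowest one-particle mode of the ladder has relaxation rate `Θ(t/K³)` per step whatever the hot refresh rate `h > 0` — the swap channel is the
bottleneck; file 3 turns this into Wilson's mixing-time floor.  Literature grade (cell rule): ELEMENTARY (the discrete Laplacian with a Robin end; D. B. Wilson 2004 used the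
cosine mode for random adjacent transpositions), NEW TYPING; nothing cited as a fact; no new bib keys.
-/

noncomputable section

open Finset Real

namespace Summit.Ventures.LatticeQCDFlow.Scaling

section RobinMode
variable {K : ℕ} {t h θ ρ : ℝ} {c : ℕ → ℝ}

/-! ## §1 The three equations -/

/-- `cos(a − θ) + cos(a + θ) = 2·cos θ·cos a`. [ours] -/
theorem robin_cos_shift (a θ : ℝ) : Real.cos (a - θ) + Real.cos (a + θ) = 2 * Real.cos θ * Real.cos a := by
  rw [Real.cos_add_cos]
  have e1 : (a - θ + (a + θ)) / 2 = a := by ring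
  have e2 : (a - θ - (a + θ)) / 2 = -θ := by ring
  rw [e1, e2, Real.cos_neg]
  ring

/-- **THE INTERIOR EQUATIONS (every `θ`):** `(t/K)(c_n − 2c_{n+1} + c_{n+2}) = −ρ·c_{n+1}` with `ρ = (2t/K)(1 − cos θ)`. [ours] -/
theorem robinMode_interior (hc : ∀ n : ℕ, c n = Real.cos (θ * ((K : ℝ) + 1 / 2 - n))) (hρ : ρ = 2 * t / K * (1 - Real.cos θ)) (n : ℕ) :
    t / K * (c n - 2 * c (n + 1) + c (n + 2)) = -ρ * c (n + 1) := by
  have h1 : c n + c (n + 2) = 2 * Real.cos θ * c (n + 1) := by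
    rw [hc n, hc (n + 2), hc (n + 1)]
    have e1 : θ * ((K : ℝ) + 1 / 2 - (n : ℕ)) = θ * ((K : ℝ) + 1 / 2 - ((n + 1 : ℕ) : ℝ)) + θ := by push_cast; ring
    have e2 : θ * ((K : ℝ) + 1 / 2 - ((n + 2 : ℕ) : ℝ)) = θ * ((K : ℝ) + 1 / 2 - ((n + 1 : ℕ) : ℝ)) - θ := by push_cast; ring
    rw [e1, e2, add_comm, robin_cos_shift]
  have e : t / K * (c n - 2 * c (n + 1) + c (n + 2)) = t / K * ((c n + c (n + 2)) - 2 * c (n + 1)) := by ring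
  rw [e, h1, hρ]
  ring

/-- **THE FAR-END (NEUMANN) EQUATION (every `θ`, `K ≥ 1`):** `(t/K)(c_{K−1} − c_K) = −ρ·c_K`. [ours] -/
theorem robinMode_neumann (hK : 1 ≤ K) (hc : ∀ n : ℕ, c n = Real.cos (θ * ((K : ℝ) + 1 / 2 - n))) (hρ : ρ = 2 * t / K * (1 - Real.cos θ)) :
    t / K * (c (K - 1) - c K) = -ρ * c K := by
  have hK' : ((K - 1 : ℕ) : ℝ) = (K : ℝ) - 1 := by rw [Nat.cast_sub hK, Nat.cast_one]
  have h1 : c (K - 1) = Real.cos (θ / 2 + θ) := by rw [hc, hK']; ring_nf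
  have h2 : c K = Real.cos (θ / 2) := by rw [hc]; ring_nf
  have h3 : Real.cos (θ / 2 - θ) = Real.cos (θ / 2) := by
    rw [show θ / 2 - θ = -(θ / 2) by ring, Real.cos_neg]
  have hid := robin_cos_shift (θ / 2) θ
  rw [h3] at hid
  rw [h1, h2, hρ]
  have : Real.cos (θ / 2 + θ) = 2 * Real.cos θ * Real.cos (θ / 2) - Real.cos (θ / 2) := by linarith
  rw [this]
  ring

/-- **THE HOT-END (ROBIN) EQUATION:** if `h·cos(θ(K+½)) = (t/K)(cos(θ(K+½)) − cos(θ(K+3/2)))` then `(t/K)(c_1 − c_0) − h·c_0 = −ρ·c_0`. [ours] -/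
theorem robinMode_robin (hc : ∀ n : ℕ, c n = Real.cos (θ * ((K : ℝ) + 1 / 2 - n))) (hρ : ρ = 2 * t / K * (1 - Real.cos θ))
    (hrobin : h * Real.cos (θ * ((K : ℝ) + 1 / 2)) = t / K * (Real.cos (θ * ((K : ℝ) + 1 / 2)) - Real.cos (θ * ((K : ℝ) + 3 / 2)))) :
    t / K * (c 1 - c 0) - h * c 0 = -ρ * c 0 := by
  have h0 : c 0 = Real.cos (θ * ((K : ℝ) + 1 / 2)) := by rw [hc]; push_cast; ring_nf
  have h1 : c 1 = Real.cos (θ * ((K : ℝ) + 1 / 2) - θ) := by rw [hc]; push_cast; ring_nf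
  have hm : Real.cos (θ * ((K : ℝ) + 3 / 2)) = Real.cos (θ * ((K : ℝ) + 1 / 2) + θ) := by ring_nf
  have hid := robin_cos_shift (θ * ((K : ℝ) + 1 / 2)) θ
  rw [h0, h1]
  rw [hm] at hrobin
  have e : t / K * (Real.cos (θ * ((K : ℝ) + 1 / 2) - θ) - Real.cos (θ * ((K : ℝ) + 1 / 2))) - h * Real.cos (θ * ((K : ℝ) + 1 / 2))
      = t / K * ((Real.cos (θ * ((K : ℝ) + 1 / 2) - θ) + Real.cos (θ * ((K : ℝ) + 1 / 2) + θ)) - 2 * Real.cos (θ * ((K : ℝ) + 1 / 2))) := by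
    rw [hrobin]; ring
  rw [e, hid, hρ]
  ring

/-! ## §2 The Robin equation has a root in `(0, π/(2K+1))` -/

/-- **EXISTENCE OF THE MODE:** `K ≥ 1`, `t > 0`, `h > 0` ⇒ some `θ` with `0 < θ`, `θ(2K+1) < π` solves `h·cos(θ(K+½)) = (t/K)(cos(θ(K+½)) − cos(θ(K+3/2)))`
(intermediate value theorem on `[0, π/(2K+1)]`: at `0` the difference is `h > 0`, at `π/(2K+1)` it is `−(t/K)·sin(π/(2K+1)) < 0`). [ours] -/
theorem robinMode_exists (hK : 1 ≤ K) (ht : 0 < t) (hh : 0 < h) :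
    ∃ θ : ℝ, 0 < θ ∧ θ * (2 * K + 1) < π ∧
      h * Real.cos (θ * ((K : ℝ) + 1 / 2)) = t / K * (Real.cos (θ * ((K : ℝ) + 1 / 2)) - Real.cos (θ * ((K : ℝ) + 3 / 2))) := by
  have hKpos : (0 : ℝ) < K := Nat.cast_pos.mpr (by omega)
  set b : ℝ := π / (2 * K + 1) with hb
  have hb0 : 0 < b := div_pos Real.pi_pos (by positivity)
  have hbpi : b < π := by
    rw [hb, div_lt_iff₀ (by positivity)]; nlinarith [Real.pi_pos]
  set g : ℝ → ℝ := fun θ => h * Real.cos (θ * ((K : ℝ) + 1 / 2)) - t / K * (Real.cos (θ * ((K : ℝ) + 1 / 2)) - Real.cos (θ * ((K : ℝ) + 3 / 2))) with hg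
  have hcont : ContinuousOn g (Set.Icc 0 b) := by
    apply Continuous.continuousOn
    rw [hg]
    fun_prop
  have hg0 : g 0 = h := by simp [hg]
  have hgb : g b = -(t / K * Real.sin b) := by
    have e1 : b * ((K : ℝ) + 1 / 2) = π / 2 := by rw [hb]; field_simp
    have e2 : b * ((K : ℝ) + 3 / 2) = b + π / 2 := by rw [hb]; field_simp; ring
    simp only [hg]
    rw [e1, e2, Real.cos_pi_div_two, Real.cos_add_pi_div_two]
    ring
  have hgb_neg : g b < 0 := by
    rw [hgb]; exact neg_neg_of_pos (mul_pos (div_pos ht hKpos) (Real.sin_pos_of_pos_of_lt_pi hb0 hbpi))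
  have hmem : (0 : ℝ) ∈ Set.Icc (g b) (g 0) := ⟨hgb_neg.le, by rw [hg0]; exact hh.le⟩
  obtain ⟨θ, ⟨hθ0, hθb⟩, hθ⟩ := intermediate_value_Icc' hb0.le hcont hmem
  have hθne0 : θ ≠ 0 := by
    rintro rfl; rw [hg0] at hθ; exact hh.ne' hθ
  have hθneb : θ ≠ b := by
    rintro rfl; exact hgb_neg.ne hθ
  refine ⟨θ, lt_of_le_of_ne hθ0 (Ne.symm hθne0), ?_, ?_⟩
  · have : θ < b := lt_of_le_of_ne hθb hθneb
    rw [hb, lt_div_iff₀ (by positivity)] at this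
    exact this
  · have : g θ = 0 := hθ
    simp only [hg] at this
    linarith

/-! ## §3 Sizes at a root -/

/-- `θ ≤ π/3` (as `3θ ≤ π`) and `θ ≤ π`. [ours] -/
theorem robinMode_theta_le (hK : 1 ≤ K) (hθ0 : 0 < θ) (hθ1 : θ * (2 * K + 1) < π) : 3 * θ < π ∧ θ ≤ π := by
  have hK1 : (1 : ℝ) ≤ K := by exact_mod_cast hK
  constructor
  · nlinarith
  · nlinarith [Real.pi_pos]

/-- **`ρ > 0`.** [ours] -/
theorem robinMode_rho_pos (hK : 1 ≤ K) (ht : 0 < t) (hθ0 : 0 < θ) (hθ1 : θ * (2 * K + 1) < π) (hρ : ρ = 2 * t / K * (1 - Real.cos θ)) : 0 < ρ := by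
  have hKpos : (0 : ℝ) < K := Nat.cast_pos.mpr (by omega)
  have hcos : Real.cos θ < 1 := by
    have := Real.cos_lt_cos_of_nonneg_of_le_pi le_rfl (robinMode_theta_le hK hθ0 hθ1).2 hθ0
    rwa [Real.cos_zero] at this
  rw [hρ]; exact mul_pos (by positivity) (by linarith)

/-- **`ρ < t/K`** (`cos θ > cos(π/3) = 1/2`); hence `ρ < 1` when `t ≤ 1`. [ours] -/
theorem robinMode_rho_lt (hK : 1 ≤ K) (ht : 0 < t) (hθ0 : 0 < θ) (hθ1 : θ * (2 * K + 1) < π) (hρ : ρ = 2 * t / K * (1 - Real.cos θ)) :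
    ρ < t / K ∧ (t ≤ 1 → ρ < 1) := by
  have hKpos : (0 : ℝ) < K := Nat.cast_pos.mpr (by omega)
  have hK1 : (1 : ℝ) ≤ K := by exact_mod_cast hK
  have hcos : 1 / 2 < Real.cos θ := by
    have h3 := (robinMode_theta_le hK hθ0 hθ1).1
    have := Real.cos_lt_cos_of_nonneg_of_le_pi hθ0.le (by linarith [Real.pi_pos]) (show θ < π / 3 by linarith)
    rwa [Real.cos_pi_div_three] at this
  have h1 : ρ < t / K := by
    rw [hρ]
    have : 2 * t / K * (1 - Real.cos θ) < 2 * t / K * (1 / 2) := mul_lt_mul_of_pos_left (by linarith) (by positivity)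
    calc 2 * t / K * (1 - Real.cos θ) < 2 * t / K * (1 / 2) := this
      _ = t / K := by ring
  refine ⟨h1, fun ht1 => lt_of_lt_of_le h1 ?_⟩
  rw [div_le_one hKpos]; linarith

/-- **THE RATE IS ORDER `t/K³`: `ρ·K(2K+1)² ≤ t·π²`** (`1 − cos θ ≤ θ²/2`, `θ(2K+1) < π`). [ours] -/
theorem robinMode_rho_mul_le (hK : 1 ≤ K) (ht : 0 < t) (hθ0 : 0 < θ) (hθ1 : θ * (2 * K + 1) < π) (hρ : ρ = 2 * t / K * (1 - Real.cos θ)) :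
    ρ * ((K : ℝ) * (2 * K + 1) ^ 2) ≤ t * π ^ 2 := by
  have hKpos : (0 : ℝ) < K := Nat.cast_pos.mpr (by omega)
  have hcos : 1 - Real.cos θ ≤ θ ^ 2 / 2 := by linarith [Real.one_sub_sq_div_two_le_cos (x := θ)]
  have hsq : (θ * (2 * K + 1)) ^ 2 ≤ π ^ 2 := pow_le_pow_left₀ (by positivity) hθ1.le 2
  have e : ρ * ((K : ℝ) * (2 * K + 1) ^ 2) = 2 * t * (1 - Real.cos θ) * (2 * K + 1) ^ 2 := by rw [hρ]; field_simp
  rw [e]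
  calc 2 * t * (1 - Real.cos θ) * (2 * (K : ℝ) + 1) ^ 2 ≤ 2 * t * (θ ^ 2 / 2) * (2 * K + 1) ^ 2 :=
        mul_le_mul_of_nonneg_right (mul_le_mul_of_nonneg_left hcos (by positivity)) (by positivity)
    _ = t * (θ * (2 * K + 1)) ^ 2 := by ring
    _ ≤ t * π ^ 2 := mul_le_mul_of_nonneg_left hsq ht.le

/-- **`4tθ² ≤ π²Kρ`** (`cos θ ≤ 1 − 2θ²/π²` for `|θ| ≤ π`). [ours] -/
theorem robinMode_theta_sq_le (hK : 1 ≤ K) (ht : 0 < t) (hθ0 : 0 < θ) (hθ1 : θ * (2 * K + 1) < π) (hρ : ρ = 2 * t / K * (1 - Real.cos θ)) :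
    4 * t * θ ^ 2 ≤ π ^ 2 * K * ρ := by
  have hKpos : (0 : ℝ) < K := Nat.cast_pos.mpr (by omega)
  have habs : |θ| ≤ π := by rw [abs_of_pos hθ0]; exact (robinMode_theta_le hK hθ0 hθ1).2
  have hcos := Real.cos_le_one_sub_mul_cos_sq habs
  have e : π ^ 2 * K * ρ = 2 * t * π ^ 2 * (1 - Real.cos θ) := by rw [hρ]; field_simp
  rw [e]
  have hpi : 0 < π ^ 2 := by positivity
  have : 2 / π ^ 2 * θ ^ 2 ≤ 1 - Real.cos θ := by linarith
  have := mul_le_mul_of_nonneg_left this (show 0 ≤ 2 * t * π ^ 2 by positivity)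
  calc 4 * t * θ ^ 2 = 2 * t * π ^ 2 * (2 / π ^ 2 * θ ^ 2) := by field_simp; ring
    _ ≤ 2 * t * π ^ 2 * (1 - Real.cos θ) := this

/-- `|c_n| ≤ 1`. [ours] -/
theorem robinMode_c_abs_le (hc : ∀ n : ℕ, c n = Real.cos (θ * ((K : ℝ) + 1 / 2 - n))) (n : ℕ) : |c n| ≤ 1 := by
  rw [hc]; exact Real.abs_cos_le_one _

/-- `(c_n − c_{n+1})² ≤ θ²` (the cosine is `1`-Lipschitz). [ours] -/
theorem robinMode_c_diff_sq_le (hc : ∀ n : ℕ, c n = Real.cos (θ * ((K : ℝ) + 1 / 2 - n))) (n : ℕ) : (c n - c (n + 1)) ^ 2 ≤ θ ^ 2 := by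
  have h := Real.abs_cos_sub_cos_le (θ * ((K : ℝ) + 1 / 2 - n)) (θ * ((K : ℝ) + 1 / 2 - ((n + 1 : ℕ) : ℝ)))
  have e : θ * ((K : ℝ) + 1 / 2 - n) - θ * ((K : ℝ) + 1 / 2 - ((n + 1 : ℕ) : ℝ)) = θ := by push_cast; ring
  rw [e, ← hc n, ← hc (n + 1)] at h
  rw [← sq_abs, ← sq_abs θ]
  exact pow_le_pow_left₀ (abs_nonneg _) h 2

/-- `0 ≤ c_0 ≤ 1` (`θ(K+½) ≤ π/2`). [ours] -/
theorem robinMode_c0_nonneg (hθ0 : 0 < θ) (hθ1 : θ * (2 * K + 1) < π) (hc : ∀ n : ℕ, c n = Real.cos (θ * ((K : ℝ) + 1 / 2 - n))) :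
    0 ≤ c 0 ∧ c 0 ≤ 1 := by
  have h0 : c 0 = Real.cos (θ * ((K : ℝ) + 1 / 2)) := by rw [hc]; push_cast; ring_nf
  rw [h0]
  refine ⟨Real.cos_nonneg_of_neg_pi_div_two_le_of_le (by nlinarith [Real.pi_pos]) (by nlinarith), Real.cos_le_one _⟩

/-- **THE HOT-END TERM, UNIFORMLY IN `θ`: `4h·c_0² ≤ π²(K+1)ρ`** — by the Robin equation `h·c_0 = (2t/K)·sin(θ(K+1))·sin(θ/2) ≤ tθ²(K+1)/K` (`sin y ≤ y` twice),
`0 ≤ c_0 ≤ 1`, and `4tθ² ≤ π²Kρ`. [ours] -/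
theorem robinMode_hot_sq_le (hK : 1 ≤ K) (ht : 0 < t) (hθ0 : 0 < θ) (hθ1 : θ * (2 * K + 1) < π)
    (hc : ∀ n : ℕ, c n = Real.cos (θ * ((K : ℝ) + 1 / 2 - n))) (hρ : ρ = 2 * t / K * (1 - Real.cos θ))
    (hrobin : h * Real.cos (θ * ((K : ℝ) + 1 / 2)) = t / K * (Real.cos (θ * ((K : ℝ) + 1 / 2)) - Real.cos (θ * ((K : ℝ) + 3 / 2)))) :
    4 * h * c 0 ^ 2 ≤ π ^ 2 * ((K : ℝ) + 1) * ρ := by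
  have hKpos : (0 : ℝ) < K := Nat.cast_pos.mpr (by omega)
  have hK1 : (1 : ℝ) ≤ K := by exact_mod_cast hK
  have h0 : c 0 = Real.cos (θ * ((K : ℝ) + 1 / 2)) := by rw [hc]; push_cast; ring_nf
  obtain ⟨hc00, hc01⟩ := robinMode_c0_nonneg hθ0 hθ1 hc
  -- the Robin equation in product form
  have hdiff : Real.cos (θ * ((K : ℝ) + 1 / 2)) - Real.cos (θ * ((K : ℝ) + 3 / 2)) = 2 * Real.sin (θ * ((K : ℝ) + 1)) * Real.sin (θ / 2) := by
    rw [Real.cos_sub_cos]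
    have e1 : (θ * ((K : ℝ) + 1 / 2) + θ * ((K : ℝ) + 3 / 2)) / 2 = θ * ((K : ℝ) + 1) := by ring
    have e2 : (θ * ((K : ℝ) + 1 / 2) - θ * ((K : ℝ) + 3 / 2)) / 2 = -(θ / 2) := by ring
    rw [e1, e2, Real.sin_neg]; ring
  have hs1 : Real.sin (θ * ((K : ℝ) + 1)) ≤ θ * ((K : ℝ) + 1) := Real.sin_le (by positivity)
  have hs1' : 0 ≤ Real.sin (θ * ((K : ℝ) + 1)) :=
    Real.sin_nonneg_of_nonneg_of_le_pi (by positivity) (by nlinarith [Real.pi_pos])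
  have hs2 : Real.sin (θ / 2) ≤ θ / 2 := Real.sin_le (by positivity)
  have hs2' : 0 ≤ Real.sin (θ / 2) := Real.sin_nonneg_of_nonneg_of_le_pi (by positivity) (by nlinarith [Real.pi_pos])
  have hprod : Real.sin (θ * ((K : ℝ) + 1)) * Real.sin (θ / 2) ≤ (θ * ((K : ℝ) + 1)) * (θ / 2) :=
    mul_le_mul hs1 hs2 hs2' (by positivity)
  -- `h·c_0 ≤ tθ²(K+1)/K`
  have hhc : h * c 0 ≤ t * θ ^ 2 * ((K : ℝ) + 1) / K := by
    rw [h0, hrobin, hdiff]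
    have := mul_le_mul_of_nonneg_left hprod (show 0 ≤ t / K * 2 by positivity)
    calc t / K * (2 * Real.sin (θ * ((K : ℝ) + 1)) * Real.sin (θ / 2)) = t / K * 2 * (Real.sin (θ * ((K : ℝ) + 1)) * Real.sin (θ / 2)) := by ring
      _ ≤ t / K * 2 * (θ * ((K : ℝ) + 1) * (θ / 2)) := this
      _ = t * θ ^ 2 * ((K : ℝ) + 1) / K := by field_simp
  -- `h·c_0² ≤ h·c_0` and the swap-side estimate
  have hsq := robinMode_theta_sq_le hK ht hθ0 hθ1 hρ
  have h1 : h * c 0 ^ 2 ≤ t * θ ^ 2 * ((K : ℝ) + 1) / K := by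
    have hh0 : 0 ≤ h * c 0 := by
      rw [h0, hrobin, hdiff]; positivity
    calc h * c 0 ^ 2 = (h * c 0) * c 0 := by ring
      _ ≤ (h * c 0) * 1 := mul_le_mul_of_nonneg_left hc01 hh0
      _ = h * c 0 := mul_one _
      _ ≤ _ := hhc
  have h2 : 4 * (t * θ ^ 2 * ((K : ℝ) + 1) / K) ≤ π ^ 2 * ((K : ℝ) + 1) * ρ := by
    rw [mul_div_assoc', div_le_iff₀ hKpos]
    have := mul_le_mul_of_nonneg_left hsq (show 0 ≤ (K : ℝ) + 1 by positivity)
    nlinarith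
  linarith

/-- **WILSON'S TWO CONSTANTS IN ONE:** `tθ² + h·c_0² ≤ 5(K+1)·ρ` (`π²/4·K + π²/4·(K+1) ≤ (π²/2)(K+1) < 5(K+1)`). [ours] -/
theorem robinMode_increment_le (hK : 1 ≤ K) (ht : 0 < t) (hθ0 : 0 < θ) (hθ1 : θ * (2 * K + 1) < π)
    (hc : ∀ n : ℕ, c n = Real.cos (θ * ((K : ℝ) + 1 / 2 - n))) (hρ : ρ = 2 * t / K * (1 - Real.cos θ))
    (hrobin : h * Real.cos (θ * ((K : ℝ) + 1 / 2)) = t / K * (Real.cos (θ * ((K : ℝ) + 1 / 2)) - Real.cos (θ * ((K : ℝ) + 3 / 2)))) :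
    t * θ ^ 2 + h * c 0 ^ 2 ≤ 5 * ((K : ℝ) + 1) * ρ := by
  have hKpos : (0 : ℝ) < K := Nat.cast_pos.mpr (by omega)
  have h1 := robinMode_theta_sq_le hK ht hθ0 hθ1 hρ
  have h2 := robinMode_hot_sq_le hK ht hθ0 hθ1 hc hρ hrobin
  have hρ0 := robinMode_rho_pos hK ht hθ0 hθ1 hρ
  have hpi : π ^ 2 < 9.93 := by nlinarith [Real.pi_lt_d2, Real.pi_pos]
  nlinarith [mul_pos hKpos hρ0]

/-! ## §4 The mode has a large mean at a constant configuration -/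

/-- `Σ_{k : Fin (n+1)} k = n(n+1)/2` in `ℝ`. [ours] -/
theorem sum_fin_cast_eq (n : ℕ) : ∑ k : Fin (n + 1), ((k : ℕ) : ℝ) = (n : ℝ) * (n + 1) / 2 := by
  have h := Fin.sum_univ_eq_sum_range (fun i : ℕ => (i : ℝ)) (n + 1)
  rw [h]
  have h2 := Finset.sum_range_id_mul_two (n + 1)
  have h3 : ((∑ i ∈ Finset.range (n + 1), i : ℕ) : ℝ) * 2 = ((n + 1 : ℕ) : ℝ) * ((n + 1 - 1 : ℕ) : ℝ) := by exact_mod_cast h2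
  rw [Nat.add_sub_cancel] at h3
  push_cast at h3
  linarith

/-- **`Σ_{k=0}^{K} c_k ≥ (K+1)/3`** for `K ≥ 1` (`cos y ≥ 1 − 2y/π` on `[0, π/2]`, `Σ_k (K+½−k) = (K+1)²/2`, `θ(K+1) ≤ 2π/3`). [ours] -/
theorem robinMode_sum_ge (hK : 1 ≤ K) (hθ0 : 0 < θ) (hθ1 : θ * (2 * K + 1) < π)
    (hc : ∀ n : ℕ, c n = Real.cos (θ * ((K : ℝ) + 1 / 2 - n))) :
    ((K : ℝ) + 1) / 3 ≤ ∑ k : Fin (K + 1), c k := by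
  have hK1 : (1 : ℝ) ≤ K := by exact_mod_cast hK
  -- termwise
  have hterm : ∀ k : Fin (K + 1), 1 - 2 / π * (θ * ((K : ℝ) + 1 / 2 - (k : ℕ))) ≤ c k := by
    intro k
    rw [hc]
    have hk : ((k : ℕ) : ℝ) ≤ K := by exact_mod_cast Nat.lt_succ_iff.mp k.2
    refine Real.one_sub_mul_le_cos (by nlinarith) ?_
    nlinarith [Real.pi_pos]
  have hsum : ∑ k : Fin (K + 1), (1 - 2 / π * (θ * ((K : ℝ) + 1 / 2 - (k : ℕ)))) = ((K : ℝ) + 1) * (1 - θ * ((K : ℝ) + 1) / π) := by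
    have e : ∀ k : Fin (K + 1), (1 - 2 / π * (θ * ((K : ℝ) + 1 / 2 - (k : ℕ)))) = (1 - 2 / π * θ * ((K : ℝ) + 1 / 2)) + (2 / π * θ) * ((k : ℕ) : ℝ) := by
      intro k; ring
    simp_rw [e]
    rw [sum_add_distrib, sum_const, card_univ, Fintype.card_fin, nsmul_eq_mul, ← mul_sum, sum_fin_cast_eq]
    push_cast
    field_simp
    ring
  have hθK : θ * ((K : ℝ) + 1) / π ≤ 2 / 3 := by
    rw [div_le_iff₀ Real.pi_pos]; nlinarith [Real.pi_pos]
  calc ((K : ℝ) + 1) / 3 ≤ ((K : ℝ) + 1) * (1 - θ * ((K : ℝ) + 1) / π) := by nlinarith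
    _ = ∑ k : Fin (K + 1), (1 - 2 / π * (θ * ((K : ℝ) + 1 / 2 - (k : ℕ)))) := hsum.symm
    _ ≤ ∑ k : Fin (K + 1), c k := sum_le_sum fun k _ => hterm k

end RobinMode

end Summit.Ventures.LatticeQCDFlow.Scaling

end
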